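import Literature.MathematicalPhysics.QuantumFieldTheory.Balaban1983to89.B3Ineq211RegularRegion
import Literature.MathematicalPhysics.QuantumFieldTheory.Balaban1983to89.B3Ineq210RegularBox
import Literature.MathematicalPhysics.QuantumFieldTheory.Balaban1983to89.B3Ineq210MixedRegularRegion
import Literature.MathematicalPhysics.QuantumFieldTheory.Balaban1983to89.B1Ineq224RegularBox

/-!
# Bałaban, *(Higgs)₂,₃ quantum fields in a finite volume III* [B3] — (2.11) p. 426 (the HÖLDER estimate for the propagators `G^η_{(j)}`)
# per scale piece (2.6) ON A CELL-PRODUCT BOX OF BIG BLOCKS `Ω ⊆ T_η`, AT A REGULAR NON-CONSTANT BACKGROUND `B̃ = A`, AT **EVERY** PAIR OF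
# BONDS AND EVERY SOURCE POINT OF `Ω` (no `R₀`-margin; [B1] p. 611 l.1–2) — PROVED, explicit form, uniformly in the volume

statement-level skeleton of published theorems with citation tags; proofs where landed; nothing here is a claim about the Yang–Mills mass gap

T. Bałaban, Commun. Math. Phys. **88** (1983) 411–445 [cite: Balaban1983Higgs3]; inputs from part I, Commun. Math. Phys. **85** (1982)
603–636 [cite: Balaban1982Higgs1], as landed in the tree.  PDF held: `paper:balaban1983-higgs-2-3-quantum-fields-finite-volume` p. 426
[PDF 16]; `paper:balaban1982-cmp85-higgs23-i` pp. 610–611 [PDF 8–9].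

CITATION HEADER (lean-in-tree rule).  Cell `lit-balaban` (HOME `run/shared/lean/pub/lit-balaban/`), Phase-2 proof seat **p35** gen 21
(unit `lit-balaban-p35`); SKELETON row **B3.Eq2.11** (owner r15; LOCATED MEMBER, no head claim); the BOX TWIN of this seat's gen 16/17
`B3Ineq211RegularRegion` (big-block unions, INTERIOR points) and the companion of `B3Ineq210RegularBox` (p346902).  USED BY NAME, never
restated: r14 g17's region pieces `B3Ineq210RegularRegion.{pieceR, sandwichR, levelSet, towerR, …}`, this seat's `B3Ineq211RegularRegion.
{holderTermR, holderTermR_nonneg, holderTermR_eq_zero_of_le, covDeriv_congr_bond}`, p26's `B3Ineq211RegularTorus.{IsAdm, cst211, …,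
norm_hol_covDeriv_sub_le_sum_coord}`, r14's `sum_CQG_le_R` / `abs_coord_CQG_le_R`, p33's bond-form `covDeriv_G_avgQkAdj_cb_eq_zero_R`, the
`R₀`-free box inputs `B3Ineq210RegularBox.norm_propagatorK_box_reg_decay_sum` ((I.2.25) value, every point) and
`B1Ineq224RegularBox.norm_holder_propagatorK_box_reg_decay_sum` ((I.2.24) Hölder, every pair of bonds, this gen), the cell refinement
`cellBox_eq_cellBox_of_le`, p35 g16 `B1Prop23RegularRegionSmall.prop23_regular_region_small` ((I.2.34)).

## What is printed (p. 426 [PDF 16], verbatim)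

*«For the propagators G^η_{(j)} we apply the inequality |G^η_{(j)}(Ω, B̃; x, x′)| ≤ O(1)(L^jη)^{−d+2}e^{−δ₁(L^jη)^{−1}|x−x′|}, (2.10) …
We need the inequality for Hölder derivative also |(δ_α G^η_{(j)}(Ω, B̃))(x₁, x₂; x)| ≤ O(1)(L^jη)^{−d+1−α}e^{−δ₁(L^jη)^{−1}min{|x₁−x|,|x₂−x|}} (2.11)
… They all are obtained by rescaling from the η-lattice to the L^{−j}-lattice and application of Propositions I.2.1 and I.2.3.»*
[Balaban1982Higgs1] p. 611 [PDF 9] l.1–2, verbatim: *«For some simple sets Ω, e.g. for rectangular parallelepipeds, the inequalities hold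
without any restrictions on the points x, x′.»*

## What this file proves (`holder_pieceR_box_bounds_small`, `ineq211At_regularBox_explicit_small`), and how

The (2.11) Hölder term of the scale piece `j` (this seat's `holderTermR`: `ε^{−d}Σ_{i′}‖U(A(Γ))(D^ε_{A,μ}G^η_{(j)}(Ω,A)e_{(x,i′)})(⟨x₂,μ⟩) −
(D^ε_{A,μ}G^η_{(j)}(Ω,A)e_{(x,i′)})(⟨x₁,μ⟩)‖`) weighted by `(|x₁−x₂|/L^j)^{−α}` is `≤ C·(L^jη)·(L^jη)^{−d}·e^{−δ₁min(|x₁−x|,|x₂−x|)/L^j}` for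
`Ω = cellBox k K₀ S`, EVERY pair of bonds `⟨x₁,x₁+εe_μ⟩, ⟨x₂,x₂+εe_μ⟩ ⊂ Ω`, every admissible contour `Γ ⊂ Ω` and EVERY source `x ∈ Ω`, at a
`δ_A`-regular non-constant background on `Ω` with the single smallness `L^k·δ_A·|e| ≤ t(K₀)`, every charge, every `L ≥ 2`, every
`0 ≤ α < 1`; and the same in print's units `(L^jη)^{−d+1−α}e^{−δ₁(L^jη)^{−1}min{…}}`.  Route = `B3Ineq211RegularRegion.ineq211At_regularRegion_small`
line by line with the engine re-run on BOND/CONTOUR hypotheses (`x₁, x₁+εe_μ, x₂, x₂+εe_μ ∈ Ω`, `Γ ⊂ Ω`) in place of the interior-site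
predicate (§1–§2), the (I.2.24)/(I.2.25) inputs being the `R₀`-free box members read at every level `l ≤ k` through `cellBox_eq_cellBox_of_le`.

## Honest scope

`Ω` a cell-product box of `L^kK₀`-cells (`K₀ ∣ M`, three cubes a side); the claim is about bonds INSIDE `Ω` and contours inside `Ω`; explicit
(un-subtyped) form only — the `ScaledKernels` carrier with `holderDiff` = supremum over admissible contours is this seat's
`regRegionKernelsH` (interior points; its supremum ranges over contours not confined to `Ω`); `m² > 0`; constants depend on `K₀` and are
chosen after the charge data and `α`; `|·|` of an `N × N` block = column sum.  No `def … : Prop`, no new named fact, no new definition;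
axioms standard.
-/

noncomputable section

open scoped BigOperators

namespace Literature.MathematicalPhysics.QuantumFieldTheory.Balaban1983to89.B3Ineq211RegularBox

open HiggsLattice (ChargeData ScalarField covDeriv)
open HiggsCovariance (propagatorK avgQkLin avgQkAdj E)
open HiggsAveraging (blockIter)
open HiggsFluctMeasure (coeff221)
open B1Eq221Coordinates (fieldCoord)
open B1Eq230FluctCov (mat Ix cb fluctCovA cb_repr)
open B1Ineq234Concrete (profile profile_nonneg' nCol)
open B1TorusChainTransport (IsTChain hol norm_hol_apply)
open B4GaugeCovariance (pathEnd)
open B1TorusCubeCover (half)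
open B1TorusRegionHSizes (IsBigBlockUnion)
open B1TorusRegionRop (chi)
open B3Ineq210RegularTorus (norm_avgQkAdj_cb_le blockIter_eq_of_avgQkAdj_cb_ne_zero blockDist_le_tdist sum3_le exp_blockIter_le
  norm_cb_le mesh_eq_pow_mul card_Ix eq_of_cb_ne_zero aSeq_sq_le covDeriv_smul'' covDeriv_zero'' mesh_mono)
open B3Ineq210RegularRegion (levelSet pieceR sandwichR pieceR_zero pieceR_of_pos pieceR_of_le
  G_avgQkAdj_cb_eq_zero abs_coord_CQG_le_R sum_CQG_le_R blockUnion_of_isBigBlockUnion isBigBlockUnion_of_le half_mono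
  propagatorK_apply_eq_chi reg223R_of_small levelSet_blockUnion towerR pieceF_towerR mat_condCov232_levelSet)
open B3Ineq210MixedRegularRegion (covDeriv_G_avgQkAdj_cb_eq_zero_R)
open B3Ineq211RegularTorus (IsAdm norm_hol_sub_le norm_hol_covDeriv_sub_le_sum_coord one_le_tdist_of_ne'
  cst211 cst211_pos le_cst211_zero le_cst211_pos)
open B3Ineq211RegularRegion (holderTermR holderTermR_nonneg holderTermR_eq_zero_of_le covDeriv_congr_bond)
open B1Ineq225RegularBox (cellBox isBigBlockUnion_cellBox)
open B3Ineq210RegularBox (refineS cellBox_eq_cellBox_of_le norm_propagatorK_box_reg_decay_sum)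
open B1Ineq224RegularBox (norm_holder_propagatorK_box_reg_decay_sum)

variable {P : HiggsLattice.Params} {N : ℕ}

/-! ## §0 Helpers -/

section Helpers

/-- Rate weakening in a decay factor. [folklore] -/
private theorem exp_rate_mono {ρ ρ' s : ℝ} (h : ρ' ≤ ρ) (hs : 0 ≤ s) : Real.exp (-(ρ * s)) ≤ Real.exp (-(ρ' * s)) :=
  Real.exp_le_exp.mpr (by nlinarith)

/-- Monotonicity of a decay factor in the distance. [folklore] -/
private theorem exp_dist_mono {ρ s s' : ℝ} (hρ : 0 ≤ ρ) (h : s' ≤ s) : Real.exp (-(ρ * s)) ≤ Real.exp (-(ρ * s')) :=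
  Real.exp_le_exp.mpr (by nlinarith)

/-- `e^{−ρa} + e^{−ρb} ≤ 2e^{−ρ·min(a,b)}` for `ρ ≥ 0`. [folklore] -/
private theorem add_exp_le_two_exp_min {ρ : ℝ} (hρ : 0 ≤ ρ) (a b : ℝ) :
    Real.exp (-(ρ * a)) + Real.exp (-(ρ * b)) ≤ 2 * Real.exp (-(ρ * min a b)) := by
  have ha := exp_dist_mono hρ (min_le_left a b)
  have hb := exp_dist_mono hρ (min_le_right a b)
  linarith

/-- The decay factor at the block distance: `e^{−δD/L^l} ≤ e^{δ}e^{−δt}` for `D = max(0, L^l·t − (L^l − 1))`. [folklore] -/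
private theorem exp_blockDist_le {l : ℕ} (t : ℝ) {δ : ℝ} (hδ : 0 ≤ δ) :
    Real.exp (-(δ * (max 0 ((P.L : ℝ) ^ l * t - ((P.L : ℝ) ^ l - 1)) / (P.L : ℝ) ^ l)))
      ≤ Real.exp δ * Real.exp (-(δ * t)) := by
  rw [← Real.exp_add]
  apply Real.exp_le_exp.mpr
  have hT : (0 : ℝ) < (P.L : ℝ) ^ l := pow_pos (by exact_mod_cast P.hL) l
  have h2 : t - 1 ≤ max 0 ((P.L : ℝ) ^ l * t - ((P.L : ℝ) ^ l - 1)) / (P.L : ℝ) ^ l := by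
    rw [le_div_iff₀ hT]
    have h1 : (P.L : ℝ) ^ l * t - ((P.L : ℝ) ^ l - 1) ≤ max 0 ((P.L : ℝ) ^ l * t - ((P.L : ℝ) ^ l - 1)) :=
      le_max_right _ _
    nlinarith
  nlinarith [mul_le_mul_of_nonneg_left h2 hδ]

/-- weakening in the exponent. [folklore] -/
private theorem exp_le_exp_of_le {u v : ℝ} (h : v ≤ u) : Real.exp (-u) ≤ Real.exp (-v) :=
  Real.exp_le_exp.mpr (neg_le_neg h)

/-- p35's rate `D/(4K₀L^l)` dominates a common rate `δ ≤ 1/(4K₀)`. [folklore] -/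
private theorem exp_p35_le {K₀ l : ℕ} (hK₀ : 0 < K₀) {δ D : ℝ} (hδ : δ ≤ 1 / (4 * K₀)) (hD : 0 ≤ D)
    (hLl : (0 : ℝ) < (P.L : ℝ) ^ l) :
    Real.exp (-(D / (4 * K₀ * (P.L : ℝ) ^ l))) ≤ Real.exp (-(δ * (D / (P.L : ℝ) ^ l))) := by
  apply exp_le_exp_of_le
  have hK : (0 : ℝ) < 4 * K₀ := by positivity
  have h1 : D / (4 * K₀ * (P.L : ℝ) ^ l) = 1 / (4 * K₀) * (D / (P.L : ℝ) ^ l) := by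
    field_simp
  rw [h1]
  exact mul_le_mul_of_nonneg_right hδ (by positivity)

/-- scaling bookkeeping: `ε^{−d}·L^{−jd} = (L^jε)^{−d}`. [cite: Balaban1982Higgs1, (1.19) p.607] -/
private theorem inv_mesh_zero_pow_mul (j : ℕ) :
    (P.mesh 0 ^ P.d)⁻¹ * (((P.L : ℝ) ^ j) ^ P.d)⁻¹ = (P.mesh j ^ P.d)⁻¹ := by
  rw [mesh_eq_pow_mul P j, mul_pow, mul_inv, mul_comm]

/-- scaling bookkeeping: `(L^jε)^{−n}(L^jε)^{n+m} = (L^jε)^m`. [cite: Balaban1982Higgs1, (1.19) p.607] -/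
private theorem mesh_pow_cancel (j n m : ℕ) : (P.mesh j ^ n)⁻¹ * P.mesh j ^ (n + m) = P.mesh j ^ m := by
  rw [pow_add, inv_mul_cancel_left₀ (pow_ne_zero _ (P.mesh_pos j).ne')]

/-- kernel: `(L^jη)^{1−d−α} = (L^jη)·((L^jη)^d)^{−1}·((L^jη)^α)^{−1}` (real exponent). [folklore] -/
private theorem rpow_one_sub_sub (j : ℕ) (α : ℝ) :
    P.mesh j ^ ((1 : ℝ) - (P.d : ℝ) - α) = P.mesh j * (P.mesh j ^ P.d)⁻¹ * (P.mesh j ^ α)⁻¹ := by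
  have hs := P.mesh_pos j
  rw [Real.rpow_sub hs, Real.rpow_sub hs, Real.rpow_one, Real.rpow_natCast _ P.d, div_eq_mul_inv, div_eq_mul_inv]

/-- kernel: `(L^jη)^{−1}·(η·m) = m/L^j`. [folklore] -/
private theorem scale_inv_mul (j : ℕ) (m : ℝ) : (P.mesh j)⁻¹ * (P.mesh 0 * m) = m / (P.L : ℝ) ^ j := by
  rw [mesh_eq_pow_mul P j, mul_inv, mul_assoc, ← mul_assoc (P.mesh 0)⁻¹, inv_mul_cancel₀ (P.mesh_pos 0).ne', one_mul,
    div_eq_inv_mul]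

/-- kernel: the weights — `(ε·t)^α·((L^jε)^α)^{−1} = (t/L^j)^α`. [folklore] -/
private theorem weight_eq (j : ℕ) {t α : ℝ} (ht : 0 ≤ t) :
    (P.mesh 0 * t) ^ α * (P.mesh j ^ α)⁻¹ = (t / (P.L : ℝ) ^ j) ^ α := by
  have hm0 : 0 < P.mesh 0 := P.mesh_pos 0
  have hmj : 0 < P.mesh j := P.mesh_pos j
  rw [← Real.inv_rpow hmj.le, ← Real.mul_rpow (mul_nonneg hm0.le ht) (inv_nonneg.mpr hmj.le)]
  congr 1
  rw [mesh_eq_pow_mul P j, mul_inv, div_eq_mul_inv]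
  calc P.mesh 0 * t * (((P.L : ℝ) ^ j)⁻¹ * (P.mesh 0)⁻¹) = t * ((P.L : ℝ) ^ j)⁻¹ * (P.mesh 0 * (P.mesh 0)⁻¹) := by ring
    _ = t * ((P.L : ℝ) ^ j)⁻¹ := by rw [mul_inv_cancel₀ hm0.ne', mul_one]

end Helpers

/-! ## §1 The Hölder engine on a region with BOND / CONTOUR hypotheses (row bonds `⊂ Ω`, contour `⊂ Ω`) -/

section EngineB

variable (C : ChargeData N) (Ω : Finset (HiggsLattice.Site P 0)) (A : HiggsLattice.VecField P 0) (msq a : ℝ) {l : ℕ} {α : ℝ}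

/-- **First kernel on a region, Hölder-transported, BOND FORM** — for bonds `⟨x₁,x₁+εe_μ⟩, ⟨x₂,x₂+εe_μ⟩ ⊂ Ω`, `x₁ ≠ x₂`, and an
admissible contour `Γ ⊂ Ω`: `(|x₁−x₂|/L^l)^{−α}‖U(A(Γ))(D^ε_AG^ε_l(Ω)Q_l^*e_s)(⟨x₂,μ⟩) − (D^ε_AG^ε_l(Ω)Q_l^*e_s)(⟨x₁,μ⟩)‖ ≤
c_H·e^{δ}·(e^{−δ|x₁,ₗ − y_s|} + e^{−δ|x₂,ₗ − y_s|})·√N` from the (I.2.24) Hölder clause at level `l` on the region in BOND form.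
[cite: Balaban1982Higgs1, Prop. 2.1 (2.24) p.610, p.611 l.1–2] [cite: Balaban1983Higgs3, (2.11) p.426] -/
theorem holder_G_avgQkAdj_cb_le_B (hl : l ≤ P.K) {cH δ : ℝ} (hcH : 0 ≤ cH) (hδ : 0 ≤ δ)
    (hH : ∀ (g : ScalarField P 0 N) (M D : ℝ), (∀ x, ‖g x‖ ≤ M) → 0 ≤ D →
      ∀ (μ : Fin P.d) (x x' : HiggsLattice.Site P 0), x' ≠ x → x ∈ Ω → x.shift μ ∈ Ω → x' ∈ Ω → x'.shift μ ∈ Ω →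
        ∀ Γ : List (HiggsLattice.Site P 0), IsTChain x Γ → pathEnd x Γ = x' → (∀ y ∈ Γ, y ∈ Ω) →
        (Γ.length : ℝ) ≤ (P.d : ℝ) * HiggsLattice.Site.tdist x x' →
        (∀ z, g z ≠ 0 → D ≤ (HiggsLattice.Site.tdist x z : ℝ)) → (∀ z, g z ≠ 0 → D ≤ (HiggsLattice.Site.tdist x' z : ℝ)) →
          (((HiggsLattice.Site.tdist x x' : ℝ) / (P.L : ℝ) ^ l)⁻¹) ^ α *
              ‖hol C A x Γ (covDeriv C A (propagatorK C Ω A msq a l g) ⟨x', μ⟩)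
                - covDeriv C A (propagatorK C Ω A msq a l g) ⟨x, μ⟩‖
            ≤ cH * Real.exp (-(δ * (D / (P.L : ℝ) ^ l))) * M)
    (s : HiggsLattice.Site P l × Ix N) (μ : Fin P.d) {x₁ x₂ : HiggsLattice.Site P 0} (hne : x₂ ≠ x₁)
    (hx₁ : x₁ ∈ Ω) (hx₁μ : x₁.shift μ ∈ Ω) (hx₂ : x₂ ∈ Ω) (hx₂μ : x₂.shift μ ∈ Ω)
    {Γ : List (HiggsLattice.Site P 0)} (hΓ : IsAdm x₁ x₂ Γ) (hΓΩ : ∀ y ∈ Γ, y ∈ Ω) :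
    (((HiggsLattice.Site.tdist x₁ x₂ : ℝ) / (P.L : ℝ) ^ l)⁻¹) ^ α *
        ‖hol C A x₁ Γ (covDeriv C A (propagatorK C Ω A msq a l (avgQkAdj C A l (cb P N l s))) ⟨x₂, μ⟩)
          - covDeriv C A (propagatorK C Ω A msq a l (avgQkAdj C A l (cb P N l s))) ⟨x₁, μ⟩‖
      ≤ cH * Real.exp δ * (Real.exp (-(δ * (HiggsLattice.Site.tdist (blockIter l x₁) s.1 : ℝ))) +
          Real.exp (-(δ * (HiggsLattice.Site.tdist (blockIter l x₂) s.1 : ℝ)))) * Real.sqrt N := by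
  set D₁ : ℝ := max 0 ((P.L : ℝ) ^ l * (HiggsLattice.Site.tdist (blockIter l x₁) s.1 : ℝ) - ((P.L : ℝ) ^ l - 1)) with hD₁
  set D₂ : ℝ := max 0 ((P.L : ℝ) ^ l * (HiggsLattice.Site.tdist (blockIter l x₂) s.1 : ℝ) - ((P.L : ℝ) ^ l - 1)) with hD₂
  have h := hH (avgQkAdj C A l (cb P N l s)) (Real.sqrt N) (min D₁ D₂) (norm_avgQkAdj_cb_le C A s)
    (le_min (le_max_left _ _) (le_max_left _ _)) μ x₁ x₂ hne hx₁ hx₁μ hx₂ hx₂μ Γ hΓ.1 hΓ.2.1 hΓΩ hΓ.2.2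
    (fun z hz => (min_le_left _ _).trans (blockDist_le_tdist hl x₁ s.1 (blockIter_eq_of_avgQkAdj_cb_ne_zero C A s hz)))
    (fun z hz => (min_le_right _ _).trans (blockDist_le_tdist hl x₂ s.1 (blockIter_eq_of_avgQkAdj_cb_ne_zero C A s hz)))
  refine h.trans ?_
  have hs : 0 ≤ Real.sqrt (N : ℝ) := Real.sqrt_nonneg _
  have he : Real.exp (-(δ * (min D₁ D₂ / (P.L : ℝ) ^ l)))
      ≤ Real.exp δ * (Real.exp (-(δ * (HiggsLattice.Site.tdist (blockIter l x₁) s.1 : ℝ))) +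
          Real.exp (-(δ * (HiggsLattice.Site.tdist (blockIter l x₂) s.1 : ℝ)))) := by
    have h1 := exp_blockDist_le (P := P) (l := l) (HiggsLattice.Site.tdist (blockIter l x₁) s.1 : ℝ) hδ
    have h2 := exp_blockDist_le (P := P) (l := l) (HiggsLattice.Site.tdist (blockIter l x₂) s.1 : ℝ) hδ
    rw [← hD₁] at h1
    rw [← hD₂] at h2
    have e1 : 0 ≤ Real.exp δ * Real.exp (-(δ * (HiggsLattice.Site.tdist (blockIter l x₁) s.1 : ℝ))) := by positivity
    have e2 : 0 ≤ Real.exp δ * Real.exp (-(δ * (HiggsLattice.Site.tdist (blockIter l x₂) s.1 : ℝ))) := by positivity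
    rcases min_choice D₁ D₂ with hm | hm <;> rw [hm] <;> linarith
  calc cH * Real.exp (-(δ * (min D₁ D₂ / (P.L : ℝ) ^ l))) * Real.sqrt N
      ≤ cH * (Real.exp δ * (Real.exp (-(δ * (HiggsLattice.Site.tdist (blockIter l x₁) s.1 : ℝ))) +
          Real.exp (-(δ * (HiggsLattice.Site.tdist (blockIter l x₂) s.1 : ℝ))))) * Real.sqrt N :=
        mul_le_mul_of_nonneg_right (mul_le_mul_of_nonneg_left he hcH) hs
    _ = _ := by ring

/-- **THE SANDWICH ON A REGION, HÖLDER-TRANSPORTED, BOND FORM** — from the three inputs at level `l ≤ K` with a common rate `δ > 0` (value at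
every point of `Ω`, Hölder at every pair of bonds of `Ω` along contours inside `Ω`, (I.2.34) on `Ω^{(l)} × Ω^{(l)}`), for bonds
`⟨x₁,x₁+εe_μ⟩, ⟨x₂,x₂+εe_μ⟩ ⊂ Ω`, `x₁ ≠ x₂`, a source point `x_q ∈ Ω` and an admissible contour `Γ ⊂ Ω`:
`(|x₁−x₂|/L^l)^{−α}‖U(A(Γ))(D^ε_A G^ε_lQ_l^*C^{(l)}Q_lG^ε_l e_q)(⟨x₂,μ⟩) − (…)(⟨x₁,μ⟩)‖ ≤ (c_He^{δ}√N)(c_Ge^{δ}√N)·c_C·L^{−ld}·(2K(δ/2)²e^{δ/2})·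
e^{−(δ/2)min(|x₁ − x_q|, |x₂ − x_q|)/L^l}` — this seat's `holder_sandwichR_cb_le`, bond form. [cite: Balaban1982Higgs1, (2.43) p.612, Prop. 2.1
(2.24)–(2.25) p.610, p.611 l.1–2, Prop. 2.3 (2.34) p.611] [cite: Balaban1983Higgs3, (2.11) p.426] -/
theorem holder_sandwichR_cb_le_B (hl : l ≤ P.K) (hmsq : 0 < msq) (hak : 0 ≤ B1.aSeq a P.L l)
    (hΩ : ∀ x x' : HiggsLattice.Site P 0, blockIter l x = blockIter l x' → (x ∈ Ω ↔ x' ∈ Ω))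
    {cG cH cC δ : ℝ} (hcG : 0 ≤ cG) (hcH : 0 ≤ cH) (hcC : 0 ≤ cC) (hδ : 0 < δ)
    (hG : ∀ (g : ScalarField P 0 N) (M D : ℝ), (∀ x, ‖g x‖ ≤ M) → 0 ≤ D →
      ∀ x, x ∈ Ω → (∀ z, g z ≠ 0 → D ≤ (HiggsLattice.Site.tdist x z : ℝ)) →
        ‖propagatorK C Ω A msq a l g x‖ ≤ cG * Real.exp (-(δ * (D / (P.L : ℝ) ^ l))) * M)
    (hH : ∀ (g : ScalarField P 0 N) (M D : ℝ), (∀ x, ‖g x‖ ≤ M) → 0 ≤ D →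
      ∀ (μ : Fin P.d) (x x' : HiggsLattice.Site P 0), x' ≠ x → x ∈ Ω → x.shift μ ∈ Ω → x' ∈ Ω → x'.shift μ ∈ Ω →
        ∀ Γ : List (HiggsLattice.Site P 0), IsTChain x Γ → pathEnd x Γ = x' → (∀ y ∈ Γ, y ∈ Ω) →
        (Γ.length : ℝ) ≤ (P.d : ℝ) * HiggsLattice.Site.tdist x x' →
        (∀ z, g z ≠ 0 → D ≤ (HiggsLattice.Site.tdist x z : ℝ)) → (∀ z, g z ≠ 0 → D ≤ (HiggsLattice.Site.tdist x' z : ℝ)) →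
          (((HiggsLattice.Site.tdist x x' : ℝ) / (P.L : ℝ) ^ l)⁻¹) ^ α *
              ‖hol C A x Γ (covDeriv C A (propagatorK C Ω A msq a l g) ⟨x', μ⟩)
                - covDeriv C A (propagatorK C Ω A msq a l g) ⟨x, μ⟩‖
            ≤ cH * Real.exp (-(δ * (D / (P.L : ℝ) ^ l))) * M)
    (hC : ∀ s t : HiggsLattice.Site P l × Ix N, s.1 ∈ levelSet l Ω → t.1 ∈ levelSet l Ω →
      |mat (fluctCovA C Ω A msq a l) s t| ≤ cC * Real.exp (-(δ * (HiggsLattice.Site.tdist s.1 t.1 : ℝ))))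
    {q : HiggsLattice.Site P 0 × Ix N} (hq : q.1 ∈ Ω) (μ : Fin P.d) {x₁ x₂ : HiggsLattice.Site P 0} (hne : x₂ ≠ x₁)
    (hx₁ : x₁ ∈ Ω) (hx₁μ : x₁.shift μ ∈ Ω) (hx₂ : x₂ ∈ Ω) (hx₂μ : x₂.shift μ ∈ Ω)
    {Γ : List (HiggsLattice.Site P 0)} (hΓ : IsAdm x₁ x₂ Γ) (hΓΩ : ∀ y ∈ Γ, y ∈ Ω) :
    (((HiggsLattice.Site.tdist x₁ x₂ : ℝ) / (P.L : ℝ) ^ l)⁻¹) ^ α *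
        ‖hol C A x₁ Γ (covDeriv C A (sandwichR C Ω A msq a l (cb P N 0 q)) ⟨x₂, μ⟩)
          - covDeriv C A (sandwichR C Ω A msq a l (cb P N 0 q)) ⟨x₁, μ⟩‖
      ≤ (cH * Real.exp δ * Real.sqrt N) * (cG * Real.exp δ * Real.sqrt N) * cC * (((P.L : ℝ) ^ l) ^ P.d)⁻¹ *
          (2 * profile P N (δ / 2) ^ 2 * Real.exp (δ / 2)) *
          Real.exp (-(δ / 2 * (min (HiggsLattice.Site.tdist x₁ q.1 : ℝ) (HiggsLattice.Site.tdist x₂ q.1 : ℝ) / (P.L : ℝ) ^ l))) := by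
  set W : ℝ := (((HiggsLattice.Site.tdist x₁ x₂ : ℝ) / (P.L : ℝ) ^ l)⁻¹) ^ α with hW
  have hW0 : 0 ≤ W := Real.rpow_nonneg (inv_nonneg.mpr (by positivity)) _
  have h0 : sandwichR C Ω A msq a l (cb P N 0 q) = (propagatorK C Ω A msq a l ∘ₗ avgQkAdj C A l)
      (fluctCovA C Ω A msq a l (avgQkLin C A l (propagatorK C Ω A msq a l (cb P N 0 q)))) := by
    simp only [sandwichR, LinearMap.comp_apply]
  rw [h0]
  have hK : 0 ≤ profile P N (δ / 2) := profile_nonneg' _ (by linarith)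
  have hgood : ∀ x : HiggsLattice.Site P 0, x ∈ Ω → x ∈ Ω := fun _ h => h
  -- coordinate expansion, the weight distributed over the sum
  refine (mul_le_mul_of_nonneg_left (norm_hol_covDeriv_sub_le_sum_coord C A _ _ x₁ x₂ Γ μ) hW0).trans ?_
  rw [Finset.mul_sum]
  calc ∑ s : HiggsLattice.Site P l × Ix N, W * (|fieldCoord (E N) (HiggsLattice.Site P l)
            (fluctCovA C Ω A msq a l (avgQkLin C A l (propagatorK C Ω A msq a l (cb P N 0 q)))) s| *
          ‖hol C A x₁ Γ (covDeriv C A ((propagatorK C Ω A msq a l ∘ₗ avgQkAdj C A l) (cb P N l s)) ⟨x₂, μ⟩)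
            - covDeriv C A ((propagatorK C Ω A msq a l ∘ₗ avgQkAdj C A l) (cb P N l s)) ⟨x₁, μ⟩‖)
      ≤ ∑ s : HiggsLattice.Site P l × Ix N,
          (∑ t : HiggsLattice.Site P l × Ix N, cC * Real.exp (-(δ * (HiggsLattice.Site.tdist s.1 t.1 : ℝ))) *
            ((((P.L : ℝ) ^ l) ^ P.d)⁻¹ *
              (cG * Real.exp δ * Real.exp (-(δ * (HiggsLattice.Site.tdist (blockIter l q.1) t.1 : ℝ))) * Real.sqrt N))) *
          (cH * Real.exp δ * (Real.exp (-(δ * (HiggsLattice.Site.tdist (blockIter l x₁) s.1 : ℝ))) +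
            Real.exp (-(δ * (HiggsLattice.Site.tdist (blockIter l x₂) s.1 : ℝ)))) * Real.sqrt N) := by
        refine Finset.sum_le_sum fun s _ => ?_
        by_cases hs : s.1 ∈ levelSet l Ω
        · have h1 : |fieldCoord (E N) (HiggsLattice.Site P l)
                (fluctCovA C Ω A msq a l (avgQkLin C A l (propagatorK C Ω A msq a l (cb P N 0 q)))) s|
              ≤ ∑ t : HiggsLattice.Site P l × Ix N, cC * Real.exp (-(δ * (HiggsLattice.Site.tdist s.1 t.1 : ℝ))) *
                ((((P.L : ℝ) ^ l) ^ P.d)⁻¹ *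
                  (cG * Real.exp δ * Real.exp (-(δ * (HiggsLattice.Site.tdist (blockIter l q.1) t.1 : ℝ))) * Real.sqrt N)) :=
            (abs_coord_CQG_le_R C Ω A msq a s q).trans
              (sum_CQG_le_R C Ω A msq a hl hmsq hak hΩ hgood hcG hcC hδ.le hG hC hs hq)
          have h2 : W * ‖hol C A x₁ Γ (covDeriv C A ((propagatorK C Ω A msq a l ∘ₗ avgQkAdj C A l) (cb P N l s)) ⟨x₂, μ⟩)
                - covDeriv C A ((propagatorK C Ω A msq a l ∘ₗ avgQkAdj C A l) (cb P N l s)) ⟨x₁, μ⟩‖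
              ≤ cH * Real.exp δ * (Real.exp (-(δ * (HiggsLattice.Site.tdist (blockIter l x₁) s.1 : ℝ))) +
                  Real.exp (-(δ * (HiggsLattice.Site.tdist (blockIter l x₂) s.1 : ℝ)))) * Real.sqrt N := by
            rw [LinearMap.comp_apply]
            exact holder_G_avgQkAdj_cb_le_B C Ω A msq a hl hcH hδ.le hH s μ hne hx₁ hx₁μ hx₂ hx₂μ hΓ hΓΩ
          calc W * (|fieldCoord (E N) (HiggsLattice.Site P l)
                  (fluctCovA C Ω A msq a l (avgQkLin C A l (propagatorK C Ω A msq a l (cb P N 0 q)))) s| *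
                ‖hol C A x₁ Γ (covDeriv C A ((propagatorK C Ω A msq a l ∘ₗ avgQkAdj C A l) (cb P N l s)) ⟨x₂, μ⟩)
                  - covDeriv C A ((propagatorK C Ω A msq a l ∘ₗ avgQkAdj C A l) (cb P N l s)) ⟨x₁, μ⟩‖)
              = |fieldCoord (E N) (HiggsLattice.Site P l)
                  (fluctCovA C Ω A msq a l (avgQkLin C A l (propagatorK C Ω A msq a l (cb P N 0 q)))) s| *
                (W * ‖hol C A x₁ Γ (covDeriv C A ((propagatorK C Ω A msq a l ∘ₗ avgQkAdj C A l) (cb P N l s)) ⟨x₂, μ⟩)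
                  - covDeriv C A ((propagatorK C Ω A msq a l ∘ₗ avgQkAdj C A l) (cb P N l s)) ⟨x₁, μ⟩‖) := by ring
            _ ≤ _ := mul_le_mul h1 h2 (mul_nonneg hW0 (norm_nonneg _)) (Finset.sum_nonneg fun t _ => by positivity)
        · -- the source block lies outside `Ω`: both covariant derivatives vanish (both bonds lie in `Ω`)
          have hz₁ : covDeriv C A ((propagatorK C Ω A msq a l ∘ₗ avgQkAdj C A l) (cb P N l s)) ⟨x₁, μ⟩ = 0 := by
            rw [LinearMap.comp_apply]
            exact covDeriv_G_avgQkAdj_cb_eq_zero_R C Ω A msq a hmsq hak hΩ s hs (c := ⟨x₁, μ⟩) hx₁ hx₁μ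
          have hz₂ : covDeriv C A ((propagatorK C Ω A msq a l ∘ₗ avgQkAdj C A l) (cb P N l s)) ⟨x₂, μ⟩ = 0 := by
            rw [LinearMap.comp_apply]
            exact covDeriv_G_avgQkAdj_cb_eq_zero_R C Ω A msq a hmsq hak hΩ s hs (c := ⟨x₂, μ⟩) hx₂ hx₂μ
          rw [hz₁, hz₂, map_zero, sub_zero, norm_zero, mul_zero, mul_zero]
          exact mul_nonneg (Finset.sum_nonneg fun t _ => by positivity) (by positivity)
    _ = (cH * Real.exp δ * Real.sqrt N) * (cG * Real.exp δ * Real.sqrt N) * cC * (((P.L : ℝ) ^ l) ^ P.d)⁻¹ *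
          ((∑ s : HiggsLattice.Site P l × Ix N, ∑ t : HiggsLattice.Site P l × Ix N,
            Real.exp (-(δ * (HiggsLattice.Site.tdist (blockIter l x₁) s.1 : ℝ))) *
              Real.exp (-(δ * (HiggsLattice.Site.tdist s.1 t.1 : ℝ))) *
              Real.exp (-(δ * (HiggsLattice.Site.tdist (blockIter l q.1) t.1 : ℝ)))) +
          (∑ s : HiggsLattice.Site P l × Ix N, ∑ t : HiggsLattice.Site P l × Ix N,
            Real.exp (-(δ * (HiggsLattice.Site.tdist (blockIter l x₂) s.1 : ℝ))) *
              Real.exp (-(δ * (HiggsLattice.Site.tdist s.1 t.1 : ℝ))) *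
              Real.exp (-(δ * (HiggsLattice.Site.tdist (blockIter l q.1) t.1 : ℝ))))) := by
        rw [← Finset.sum_add_distrib, Finset.mul_sum]
        refine Finset.sum_congr rfl fun s _ => ?_
        rw [← Finset.sum_add_distrib, Finset.sum_mul, Finset.mul_sum]
        refine Finset.sum_congr rfl fun t _ => ?_
        ring
    _ ≤ (cH * Real.exp δ * Real.sqrt N) * (cG * Real.exp δ * Real.sqrt N) * cC * (((P.L : ℝ) ^ l) ^ P.d)⁻¹ *
          (profile P N (δ / 2) ^ 2 * Real.exp (-(δ / 2 * (HiggsLattice.Site.tdist (blockIter l x₁) (blockIter l q.1) : ℝ))) +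
            profile P N (δ / 2) ^ 2 * Real.exp (-(δ / 2 * (HiggsLattice.Site.tdist (blockIter l x₂) (blockIter l q.1) : ℝ)))) :=
        mul_le_mul_of_nonneg_left (add_le_add (sum3_le hδ (blockIter l x₁) (blockIter l q.1) q.2)
          (sum3_le hδ (blockIter l x₂) (blockIter l q.1) q.2)) (by positivity)
    _ ≤ (cH * Real.exp δ * Real.sqrt N) * (cG * Real.exp δ * Real.sqrt N) * cC * (((P.L : ℝ) ^ l) ^ P.d)⁻¹ *
          (profile P N (δ / 2) ^ 2 * (Real.exp (δ / 2) *
            Real.exp (-(δ / 2 * ((HiggsLattice.Site.tdist x₁ q.1 : ℝ) / (P.L : ℝ) ^ l)))) +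
          profile P N (δ / 2) ^ 2 * (Real.exp (δ / 2) *
            Real.exp (-(δ / 2 * ((HiggsLattice.Site.tdist x₂ q.1 : ℝ) / (P.L : ℝ) ^ l))))) :=
        mul_le_mul_of_nonneg_left (add_le_add
          (mul_le_mul_of_nonneg_left (exp_blockIter_le hl hδ.le x₁ q.1) (pow_nonneg hK 2))
          (mul_le_mul_of_nonneg_left (exp_blockIter_le hl hδ.le x₂ q.1) (pow_nonneg hK 2))) (by positivity)
    _ = (cH * Real.exp δ * Real.sqrt N) * (cG * Real.exp δ * Real.sqrt N) * cC * (((P.L : ℝ) ^ l) ^ P.d)⁻¹ *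
          (profile P N (δ / 2) ^ 2 * Real.exp (δ / 2)) *
          (Real.exp (-(δ / 2 * ((HiggsLattice.Site.tdist x₁ q.1 : ℝ) / (P.L : ℝ) ^ l))) +
            Real.exp (-(δ / 2 * ((HiggsLattice.Site.tdist x₂ q.1 : ℝ) / (P.L : ℝ) ^ l)))) := by ring
    _ ≤ (cH * Real.exp δ * Real.sqrt N) * (cG * Real.exp δ * Real.sqrt N) * cC * (((P.L : ℝ) ^ l) ^ P.d)⁻¹ *
          (profile P N (δ / 2) ^ 2 * Real.exp (δ / 2)) *
          (2 * Real.exp (-(δ / 2 * (min (HiggsLattice.Site.tdist x₁ q.1 : ℝ) (HiggsLattice.Site.tdist x₂ q.1 : ℝ) /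
            (P.L : ℝ) ^ l)))) := by
        refine mul_le_mul_of_nonneg_left ?_ (by positivity)
        have hT : (0 : ℝ) < (P.L : ℝ) ^ l := pow_pos (by exact_mod_cast P.hL) l
        rw [← min_div_div_right hT.le]
        exact add_exp_le_two_exp_min (by linarith) _ _
    _ = _ := by ring

end EngineB

/-! ## §2 The pieces on a box, bond form -/

section PieceBoundsB

variable (C : ChargeData N) (Ω : Finset (HiggsLattice.Site P 0)) (A : HiggsLattice.VecField P 0) (msq : ℝ) {a : ℝ} {k j : ℕ}
  {α : ℝ}

/-- **Piece `j = 0`, bond form**: `(|x₁−x₂|/L^0)^{−α}·holderTerm ≤ N√N·c_H·L·ε·ε^{−d}·e^{−ρ·min(|x₁−x|,|x₂−x|)/L}` from the (I.2.24) Hölder clause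
at level `1` at the bonds `⟨x₁,x₁+εe_μ⟩, ⟨x₂,x₂+εe_μ⟩ ⊂ Ω` along `Γ ⊂ Ω` (source `e_{(x,i′)}`: sup `≤ √N`, support `{x}`).
[cite: Balaban1983Higgs3, (2.6) p.424, (2.11) p.426] [cite: Balaban1982Higgs1, Prop. 2.1 (2.24) p.610, p.611 l.1–2] -/
theorem holder_pieceB_zero_le (hα : 0 ≤ α) {cH ρ : ℝ}
    (hH : ∀ (g : ScalarField P 0 N) (M D : ℝ), (∀ x, ‖g x‖ ≤ M) → 0 ≤ D →
      ∀ (μ : Fin P.d) (x x' : HiggsLattice.Site P 0), x' ≠ x → x ∈ Ω → x.shift μ ∈ Ω → x' ∈ Ω → x'.shift μ ∈ Ω →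
        ∀ Γ : List (HiggsLattice.Site P 0), IsTChain x Γ → pathEnd x Γ = x' → (∀ y ∈ Γ, y ∈ Ω) →
        (Γ.length : ℝ) ≤ (P.d : ℝ) * HiggsLattice.Site.tdist x x' →
        (∀ z, g z ≠ 0 → D ≤ (HiggsLattice.Site.tdist x z : ℝ)) → (∀ z, g z ≠ 0 → D ≤ (HiggsLattice.Site.tdist x' z : ℝ)) →
          (((HiggsLattice.Site.tdist x x' : ℝ) / (P.L : ℝ) ^ 1)⁻¹) ^ α *
              ‖hol C A x Γ (covDeriv C A (propagatorK C Ω A msq a 1 g) ⟨x', μ⟩)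
                - covDeriv C A (propagatorK C Ω A msq a 1 g) ⟨x, μ⟩‖
            ≤ cH * P.mesh 1 * Real.exp (-(ρ * (D / (P.L : ℝ) ^ 1))) * M)
    (μ : Fin P.d) {x₁ x₂ : HiggsLattice.Site P 0} (hne : x₂ ≠ x₁)
    (hx₁ : x₁ ∈ Ω) (hx₁μ : x₁.shift μ ∈ Ω) (hx₂ : x₂ ∈ Ω) (hx₂μ : x₂.shift μ ∈ Ω) (x : HiggsLattice.Site P 0)
    {Γ : List (HiggsLattice.Site P 0)} (hΓ : IsAdm x₁ x₂ Γ) (hΓΩ : ∀ y ∈ Γ, y ∈ Ω) :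
    (((HiggsLattice.Site.tdist x₁ x₂ : ℝ) / (P.L : ℝ) ^ 0)⁻¹) ^ α * holderTermR C Ω A msq a k 0 μ x₁ x₂ x Γ
      ≤ ((N : ℝ) * Real.sqrt N * cH * (P.L : ℝ)) * (P.mesh 0 * (P.mesh 0 ^ P.d)⁻¹) *
          Real.exp (-(ρ * (min (HiggsLattice.Site.tdist x₁ x : ℝ) (HiggsLattice.Site.tdist x₂ x : ℝ) / (P.L : ℝ) ^ 1))) := by
  set W₀ : ℝ := (((HiggsLattice.Site.tdist x₁ x₂ : ℝ) / (P.L : ℝ) ^ 0)⁻¹) ^ α with hW₀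
  set W₁ : ℝ := (((HiggsLattice.Site.tdist x₁ x₂ : ℝ) / (P.L : ℝ) ^ 1)⁻¹) ^ α with hW₁
  set X := Real.exp (-(ρ * (min (HiggsLattice.Site.tdist x₁ x : ℝ) (HiggsLattice.Site.tdist x₂ x : ℝ) / (P.L : ℝ) ^ 1))) with hX
  have hL1 : (1 : ℝ) ≤ P.L := by exact_mod_cast P.hL
  have ht0 : (0 : ℝ) ≤ (HiggsLattice.Site.tdist x₁ x₂ : ℝ) := Nat.cast_nonneg _
  have hW₀1 : W₀ ≤ W₁ := by
    rw [hW₀, hW₁, pow_zero, div_one, pow_one, inv_div, div_eq_mul_inv]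
    exact Real.rpow_le_rpow (inv_nonneg.mpr ht0) (le_mul_of_one_le_left (inv_nonneg.mpr ht0) hL1) hα
  have h1 : ∀ i' : Ix N, W₁ * ‖hol C A x₁ Γ (covDeriv C A (pieceR C Ω A msq a k 0 (cb P N 0 (x, i'))) ⟨x₂, μ⟩)
        - covDeriv C A (pieceR C Ω A msq a k 0 (cb P N 0 (x, i'))) ⟨x₁, μ⟩‖ ≤ cH * P.mesh 1 * X * Real.sqrt N := by
    intro i'
    rw [pieceR_zero]
    exact hH (cb P N 0 (x, i')) (Real.sqrt N) (min (HiggsLattice.Site.tdist x₁ x : ℝ) (HiggsLattice.Site.tdist x₂ x : ℝ))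
      (norm_cb_le _) (le_min (Nat.cast_nonneg _) (Nat.cast_nonneg _)) μ x₁ x₂ hne hx₁ hx₁μ hx₂ hx₂μ Γ hΓ.1 hΓ.2.1 hΓΩ hΓ.2.2
      (fun z hz => by rw [eq_of_cb_ne_zero _ hz]; exact min_le_left _ _)
      (fun z hz => by rw [eq_of_cb_ne_zero _ hz]; exact min_le_right _ _)
  have hsum : W₁ * ∑ i' : Ix N, ‖hol C A x₁ Γ (covDeriv C A (pieceR C Ω A msq a k 0 (cb P N 0 (x, i'))) ⟨x₂, μ⟩)
        - covDeriv C A (pieceR C Ω A msq a k 0 (cb P N 0 (x, i'))) ⟨x₁, μ⟩‖ ≤ N * (cH * P.mesh 1 * X * Real.sqrt N) := by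
    rw [Finset.mul_sum]
    refine (Finset.sum_le_sum fun i' _ => h1 i').trans ?_
    rw [Finset.sum_const, card_Ix, nsmul_eq_mul]
  have hm0 : 0 ≤ (P.mesh 0 ^ P.d)⁻¹ := inv_nonneg.mpr (pow_nonneg (P.mesh_pos 0).le _)
  calc W₀ * holderTermR C Ω A msq a k 0 μ x₁ x₂ x Γ
      ≤ W₁ * holderTermR C Ω A msq a k 0 μ x₁ x₂ x Γ :=
        mul_le_mul_of_nonneg_right hW₀1 (holderTermR_nonneg C Ω A msq μ x₁ x₂ x Γ)
    _ = (P.mesh 0 ^ P.d)⁻¹ * (W₁ * ∑ i' : Ix N, ‖hol C A x₁ Γ (covDeriv C A (pieceR C Ω A msq a k 0 (cb P N 0 (x, i'))) ⟨x₂, μ⟩)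
        - covDeriv C A (pieceR C Ω A msq a k 0 (cb P N 0 (x, i'))) ⟨x₁, μ⟩‖) := by unfold holderTermR; ring
    _ ≤ (P.mesh 0 ^ P.d)⁻¹ * (N * (cH * P.mesh 1 * X * Real.sqrt N)) := mul_le_mul_of_nonneg_left hsum hm0
    _ = _ := by rw [mesh_eq_pow_mul P 1, pow_one]; ring

/-- **Piece `1 ≤ j < k`, bond form**: `(|x₁−x₂|/L^j)^{−α}·holderTerm ≤ N²a²(c_Hc₀)c₁·e^{2δ}(2e^{δ/2})K(δ/2)² · (L^jε)(L^jε)^{−d} ·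
e^{−(δ/2)min(|x₁−x|,|x₂−x|)/L^j}` at bonds `⊂ Ω`, source `x ∈ Ω`, contour `⊂ Ω` — this seat's `holder_pieceR_pos_le`, bond form.
[cite: Balaban1983Higgs3, (2.6) p.424, (2.11) p.426] [cite: Balaban1982Higgs1, (2.43) p.612, p.611 l.1–2] -/
theorem holder_pieceB_pos_le (ha : 0 < a) (hL1 : 1 < P.L) (hj1 : 1 ≤ j) (hjk : j < k) (hjK : j ≤ P.K) (hmsq : 0 < msq)
    (hΩ : ∀ x x' : HiggsLattice.Site P 0, blockIter j x = blockIter j x' → (x ∈ Ω ↔ x' ∈ Ω))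
    {c₀ cH c₁ δ : ℝ} (hc₀ : 0 ≤ c₀) (hcH : 0 ≤ cH) (hc₁ : 0 ≤ c₁) (hδ : 0 < δ)
    (hG : ∀ (g : ScalarField P 0 N) (M D : ℝ), (∀ x, ‖g x‖ ≤ M) → 0 ≤ D →
      ∀ x, x ∈ Ω → (∀ z, g z ≠ 0 → D ≤ (HiggsLattice.Site.tdist x z : ℝ)) →
        ‖propagatorK C Ω A msq a j g x‖ ≤ c₀ * P.mesh j ^ 2 * Real.exp (-(δ * (D / (P.L : ℝ) ^ j))) * M)
    (hH : ∀ (g : ScalarField P 0 N) (M D : ℝ), (∀ x, ‖g x‖ ≤ M) → 0 ≤ D →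
      ∀ (μ : Fin P.d) (x x' : HiggsLattice.Site P 0), x' ≠ x → x ∈ Ω → x.shift μ ∈ Ω → x' ∈ Ω → x'.shift μ ∈ Ω →
        ∀ Γ : List (HiggsLattice.Site P 0), IsTChain x Γ → pathEnd x Γ = x' → (∀ y ∈ Γ, y ∈ Ω) →
        (Γ.length : ℝ) ≤ (P.d : ℝ) * HiggsLattice.Site.tdist x x' →
        (∀ z, g z ≠ 0 → D ≤ (HiggsLattice.Site.tdist x z : ℝ)) → (∀ z, g z ≠ 0 → D ≤ (HiggsLattice.Site.tdist x' z : ℝ)) →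
          (((HiggsLattice.Site.tdist x x' : ℝ) / (P.L : ℝ) ^ j)⁻¹) ^ α *
              ‖hol C A x Γ (covDeriv C A (propagatorK C Ω A msq a j g) ⟨x', μ⟩)
                - covDeriv C A (propagatorK C Ω A msq a j g) ⟨x, μ⟩‖
            ≤ cH * P.mesh j * Real.exp (-(δ * (D / (P.L : ℝ) ^ j))) * M)
    (hC : ∀ s t : HiggsLattice.Site P j × Ix N, s.1 ∈ levelSet j Ω → t.1 ∈ levelSet j Ω →
      |mat (fluctCovA C Ω A msq a j) s t| ≤ c₁ * P.mesh j ^ 2 * Real.exp (-(δ * (HiggsLattice.Site.tdist s.1 t.1 : ℝ))))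
    (μ : Fin P.d) {x₁ x₂ : HiggsLattice.Site P 0} (hne : x₂ ≠ x₁)
    (hx₁ : x₁ ∈ Ω) (hx₁μ : x₁.shift μ ∈ Ω) (hx₂ : x₂ ∈ Ω) (hx₂μ : x₂.shift μ ∈ Ω) {x : HiggsLattice.Site P 0}
    (hx : x ∈ Ω) {Γ : List (HiggsLattice.Site P 0)} (hΓ : IsAdm x₁ x₂ Γ) (hΓΩ : ∀ y ∈ Γ, y ∈ Ω) :
    (((HiggsLattice.Site.tdist x₁ x₂ : ℝ) / (P.L : ℝ) ^ j)⁻¹) ^ α * holderTermR C Ω A msq a k j μ x₁ x₂ x Γ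
      ≤ ((N : ℝ) ^ 2 * a ^ 2 * (cH * c₀) * c₁ * (Real.exp δ ^ 2 * (2 * Real.exp (δ / 2)) * profile P N (δ / 2) ^ 2)) *
        (P.mesh j * (P.mesh j ^ P.d)⁻¹) *
          Real.exp (-(δ / 2 * (min (HiggsLattice.Site.tdist x₁ x : ℝ) (HiggsLattice.Site.tdist x₂ x : ℝ) / (P.L : ℝ) ^ j))) := by
  set W : ℝ := (((HiggsLattice.Site.tdist x₁ x₂ : ℝ) / (P.L : ℝ) ^ j)⁻¹) ^ α with hW
  set X := Real.exp (-(δ / 2 * (min (HiggsLattice.Site.tdist x₁ x : ℝ) (HiggsLattice.Site.tdist x₂ x : ℝ) / (P.L : ℝ) ^ j)))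
    with hX
  have hW0 : 0 ≤ W := Real.rpow_nonneg (inv_nonneg.mpr (by positivity)) _
  have hm0 : 0 < P.mesh 0 := P.mesh_pos 0
  have hmj : 0 < P.mesh j := P.mesh_pos j
  have hLj : (0 : ℝ) < (P.L : ℝ) ^ j := pow_pos (by exact_mod_cast P.hL) j
  have hak : 0 ≤ B1.aSeq a P.L j := (B1.aSeq_pos ha (by exact_mod_cast hL1) hj1).le
  have hG' : ∀ (g : ScalarField P 0 N) (M D : ℝ), (∀ x, ‖g x‖ ≤ M) → 0 ≤ D →
      ∀ x, x ∈ Ω → (∀ z, g z ≠ 0 → D ≤ (HiggsLattice.Site.tdist x z : ℝ)) →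
        ‖propagatorK C Ω A msq a j g x‖ ≤ (c₀ * P.mesh j ^ 2) * Real.exp (-(δ * (D / (P.L : ℝ) ^ j))) * M :=
    fun g M D hg hD x hx hs => hG g M D hg hD x hx hs
  have hH' : ∀ (g : ScalarField P 0 N) (M D : ℝ), (∀ x, ‖g x‖ ≤ M) → 0 ≤ D →
      ∀ (μ : Fin P.d) (x x' : HiggsLattice.Site P 0), x' ≠ x → x ∈ Ω → x.shift μ ∈ Ω → x' ∈ Ω → x'.shift μ ∈ Ω →
        ∀ Γ : List (HiggsLattice.Site P 0), IsTChain x Γ → pathEnd x Γ = x' → (∀ y ∈ Γ, y ∈ Ω) →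
        (Γ.length : ℝ) ≤ (P.d : ℝ) * HiggsLattice.Site.tdist x x' →
        (∀ z, g z ≠ 0 → D ≤ (HiggsLattice.Site.tdist x z : ℝ)) → (∀ z, g z ≠ 0 → D ≤ (HiggsLattice.Site.tdist x' z : ℝ)) →
          (((HiggsLattice.Site.tdist x x' : ℝ) / (P.L : ℝ) ^ j)⁻¹) ^ α *
              ‖hol C A x Γ (covDeriv C A (propagatorK C Ω A msq a j g) ⟨x', μ⟩)
                - covDeriv C A (propagatorK C Ω A msq a j g) ⟨x, μ⟩‖
            ≤ (cH * P.mesh j) * Real.exp (-(δ * (D / (P.L : ℝ) ^ j))) * M :=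
    fun g M D hg hD μ x x' hne hx hxμ hx' hx'μ Γ h1 h2 h3 h4 h5 h6 => hH g M D hg hD μ x x' hne hx hxμ hx' hx'μ Γ h1 h2 h3 h4 h5 h6
  have hC' : ∀ s t : HiggsLattice.Site P j × Ix N, s.1 ∈ levelSet j Ω → t.1 ∈ levelSet j Ω →
      |mat (fluctCovA C Ω A msq a j) s t| ≤ (c₁ * P.mesh j ^ 2) * Real.exp (-(δ * (HiggsLattice.Site.tdist s.1 t.1 : ℝ))) :=
    fun s t hs ht => hC s t hs ht
  -- one colour: the bond-form sandwich engine with `cH := c_H·L^jε`, `cG := c₀(L^jε)²`, `cC := c₁(L^jε)²`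
  have hsw : ∀ i' : Ix N, W * ‖hol C A x₁ Γ (covDeriv C A (pieceR C Ω A msq a k j (cb P N 0 (x, i'))) ⟨x₂, μ⟩)
        - covDeriv C A (pieceR C Ω A msq a k j (cb P N 0 (x, i'))) ⟨x₁, μ⟩‖
      ≤ coeff221 P a j ^ 2 * ((cH * P.mesh j * Real.exp δ * Real.sqrt N) * (c₀ * P.mesh j ^ 2 * Real.exp δ * Real.sqrt N) *
          (c₁ * P.mesh j ^ 2) * (((P.L : ℝ) ^ j) ^ P.d)⁻¹ * (2 * profile P N (δ / 2) ^ 2 * Real.exp (δ / 2)) * X) := by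
    intro i'
    rw [pieceR_of_pos hj1 hjk, LinearMap.smul_apply, covDeriv_smul'', covDeriv_smul'', map_smul, ← smul_sub, norm_smul,
      Real.norm_eq_abs, abs_of_nonneg (sq_nonneg _), mul_left_comm]
    exact mul_le_mul_of_nonneg_left
      (holder_sandwichR_cb_le_B C Ω A msq a hjK hmsq hak hΩ (by positivity) (by positivity) (by positivity) hδ hG' hH' hC'
        (q := (x, i')) hx μ hne hx₁ hx₁μ hx₂ hx₂μ hΓ hΓΩ)
      (sq_nonneg _)
  have hsum : W * ∑ i' : Ix N, ‖hol C A x₁ Γ (covDeriv C A (pieceR C Ω A msq a k j (cb P N 0 (x, i'))) ⟨x₂, μ⟩)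
        - covDeriv C A (pieceR C Ω A msq a k j (cb P N 0 (x, i'))) ⟨x₁, μ⟩‖
      ≤ N * (coeff221 P a j ^ 2 * ((cH * P.mesh j * Real.exp δ * Real.sqrt N) * (c₀ * P.mesh j ^ 2 * Real.exp δ * Real.sqrt N) *
          (c₁ * P.mesh j ^ 2) * (((P.L : ℝ) ^ j) ^ P.d)⁻¹ * (2 * profile P N (δ / 2) ^ 2 * Real.exp (δ / 2)) * X)) := by
    rw [Finset.mul_sum]
    refine (Finset.sum_le_sum fun i' _ => hsw i').trans ?_
    rw [Finset.sum_const, card_Ix, nsmul_eq_mul]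
  have hstep : W * holderTermR C Ω A msq a k j μ x₁ x₂ x Γ
      = (P.mesh 0 ^ P.d)⁻¹ * (W * ∑ i' : Ix N, ‖hol C A x₁ Γ (covDeriv C A (pieceR C Ω A msq a k j (cb P N 0 (x, i'))) ⟨x₂, μ⟩)
        - covDeriv C A (pieceR C Ω A msq a k j (cb P N 0 (x, i'))) ⟨x₁, μ⟩‖) := by unfold holderTermR; ring
  rw [hstep]
  refine (mul_le_mul_of_nonneg_left hsum (inv_nonneg.mpr (pow_nonneg hm0.le _))).trans ?_
  rw [B1Eq243HiggsModel.coeff221_sq]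
  have hre : (cH * P.mesh j * Real.exp δ * Real.sqrt N) * (c₀ * P.mesh j ^ 2 * Real.exp δ * Real.sqrt N)
      = cH * c₀ * P.mesh j ^ 3 * Real.exp δ ^ 2 * N := by
    have h := Real.mul_self_sqrt (Nat.cast_nonneg N : (0 : ℝ) ≤ N)
    calc (cH * P.mesh j * Real.exp δ * Real.sqrt N) * (c₀ * P.mesh j ^ 2 * Real.exp δ * Real.sqrt N)
        = cH * c₀ * P.mesh j ^ 3 * Real.exp δ ^ 2 * (Real.sqrt N * Real.sqrt N) := by ring
      _ = _ := by rw [h]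
  rw [hre]
  have hid : (P.mesh 0 ^ P.d)⁻¹ * (N * (B1.aSeq a (P.L : ℝ) j ^ 2 * (P.mesh j ^ 4)⁻¹ *
        (cH * c₀ * P.mesh j ^ 3 * Real.exp δ ^ 2 * N * (c₁ * P.mesh j ^ 2) *
          (((P.L : ℝ) ^ j) ^ P.d)⁻¹ * (2 * profile P N (δ / 2) ^ 2 * Real.exp (δ / 2)) * X)))
      = B1.aSeq a (P.L : ℝ) j ^ 2 * (((N : ℝ) ^ 2 * a ^ 2 * (cH * c₀) * c₁ *
          (Real.exp δ ^ 2 * (2 * Real.exp (δ / 2)) * profile P N (δ / 2) ^ 2)) * (P.mesh j * (P.mesh j ^ P.d)⁻¹) * X) / a ^ 2 := by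
    rw [eq_div_iff (pow_ne_zero 2 ha.ne')]
    calc (P.mesh 0 ^ P.d)⁻¹ * (N * (B1.aSeq a (P.L : ℝ) j ^ 2 * (P.mesh j ^ 4)⁻¹ *
          (cH * c₀ * P.mesh j ^ 3 * Real.exp δ ^ 2 * N * (c₁ * P.mesh j ^ 2) *
            (((P.L : ℝ) ^ j) ^ P.d)⁻¹ * (2 * profile P N (δ / 2) ^ 2 * Real.exp (δ / 2)) * X))) * a ^ 2
        = B1.aSeq a (P.L : ℝ) j ^ 2 * (((N : ℝ) ^ 2 * a ^ 2 * (cH * c₀) * c₁ *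
            (Real.exp δ ^ 2 * (2 * Real.exp (δ / 2)) * profile P N (δ / 2) ^ 2)) * X) *
            ((P.mesh 0 ^ P.d)⁻¹ * (((P.L : ℝ) ^ j) ^ P.d)⁻¹) * ((P.mesh j ^ 4)⁻¹ * P.mesh j ^ (4 + 1)) := by ring
      _ = _ := by rw [inv_mesh_zero_pow_mul, mesh_pow_cancel, pow_one]; ring
  rw [hid, div_le_iff₀ (pow_pos ha 2)]
  have hrest : 0 ≤ ((N : ℝ) ^ 2 * a ^ 2 * (cH * c₀) * c₁ * (Real.exp δ ^ 2 * (2 * Real.exp (δ / 2)) * profile P N (δ / 2) ^ 2)) *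
      (P.mesh j * (P.mesh j ^ P.d)⁻¹) * X := by
    have hK : 0 ≤ profile P N (δ / 2) := profile_nonneg' _ (by linarith)
    positivity
  calc B1.aSeq a (P.L : ℝ) j ^ 2 * (((N : ℝ) ^ 2 * a ^ 2 * (cH * c₀) * c₁ *
          (Real.exp δ ^ 2 * (2 * Real.exp (δ / 2)) * profile P N (δ / 2) ^ 2)) * (P.mesh j * (P.mesh j ^ P.d)⁻¹) * X)
      ≤ a ^ 2 * (((N : ℝ) ^ 2 * a ^ 2 * (cH * c₀) * c₁ *
          (Real.exp δ ^ 2 * (2 * Real.exp (δ / 2)) * profile P N (δ / 2) ^ 2)) * (P.mesh j * (P.mesh j ^ P.d)⁻¹) * X) :=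
        mul_le_mul_of_nonneg_right (aSeq_sq_le ha hL1 hj1) hrest
    _ = _ := by ring

end PieceBoundsB

/-! ## §3 The theorem: (2.11) on cell-product boxes at a regular background, EVERY pair of bonds and every source, explicit form -/

section MainB

set_option maxHeartbeats 1600000 in
/-- **B3 (2.11) p. 426 [PDF 16] PROVED ON A CELL-PRODUCT BOX OF BIG BLOCKS AT A REGULAR NON-CONSTANT BACKGROUND `B̃ = A`, AT EVERY PAIR OF BONDS
AND EVERY SOURCE POINT OF THE BOX, uniformly in the volume — ONE SMALLNESS PARAMETER, the Hölder-weighted terms in the model's natural units.**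
For `d ≥ 1`, `L ≥ 2`, `a, m² > 0`, `N` and EVERY charge there is a threshold `K₀,min` and, for every `0 ≤ α < 1` and every cube size
`K₀ ≥ K₀,min`, constants `t, δ₁, C > 0` such that: for every volume `P` with these `d, L` and `K₀ ∣ M`, every scale `1 ≤ k ≤ K` with
`L^kε ≤ 1` and `3L^kK₀ ≤ |T_ε|_μ`, every cell-product box `Ω = cellBox k K₀ S`, every configuration `A` that is `δ_A`-REGULAR ON `Ω` with
`L^k·δ_A·|e| ≤ t`: for all pieces `j`, all directions `μ`, ALL `x₁ ≠ x₂` with the bonds `⟨x₁,x₁+εe_μ⟩, ⟨x₂,x₂+εe_μ⟩ ⊂ Ω`, every admissible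
contour `Γ` from `x₁` to `x₂` INSIDE `Ω` (`|Γ| ≤ d|x₁−x₂|`) and EVERY source `x ∈ Ω`:
`(|x₁−x₂|/L^j)^{−α} · ε^{−d}Σ_{i′}‖U(A(Γ))(D^ε_{A,μ}G^η_{(j)}(Ω,A)e_{(x,i′)})(⟨x₂,μ⟩) − (…)(⟨x₁,μ⟩)‖ ≤ C·(L^jε)(L^jε)^{−d}·e^{−δ₁min(|x₁−x|,|x₂−x|)/L^j}`
— *«For some simple sets Ω, e.g. for rectangular parallelepipeds, the inequalities hold without any restrictions on the points x, x′»* (part I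
p. 611 l.1–2) carried into (2.11).  Route = this seat's `ineq211At_regularRegion_small` with the (I.2.24)/(I.2.25) inputs replaced by the
`R₀`-free box members (`B1Ineq224RegularBox.norm_holder_propagatorK_box_reg_decay_sum`, `B3Ineq210RegularBox.norm_propagatorK_box_reg_decay_sum`)
read at every level `l ≤ k` through `cellBox_eq_cellBox_of_le`, and the engine re-run in bond form (§1–§2).  Honest scope: module docstring.
[cite: Balaban1983Higgs3, (2.6) p.424, (2.11) p.426] [cite: Balaban1982Higgs1, Prop. 2.1 (2.23)–(2.25) p.610, p.611 l.1–2, Prop. 2.3 (2.34)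
p.611, (2.43) p.612] -/
theorem holder_pieceR_box_bounds_small (d L : ℕ) (hd : 1 ≤ d) (hL : 2 ≤ L) {a : ℝ} (ha : 0 < a) {msq : ℝ} (hmsq : 0 < msq)
    (N : ℕ) (C : ChargeData N) :
    ∃ K₀min : ℕ, ∀ {α : ℝ}, 0 ≤ α → α < 1 → ∀ K₀ : ℕ, K₀min ≤ K₀ → ∃ t δ₁ Cst : ℝ, 0 < t ∧ 0 < δ₁ ∧ 0 < Cst ∧
      ∀ (P : HiggsLattice.Params), P.d = d → P.L = L → K₀ ∣ P.M →
      ∀ {k : ℕ}, 1 ≤ k → k ≤ P.K → (∀ μ, 3 * half P k K₀ ≤ P.sitesPerDir 0 μ) → P.mesh k ≤ 1 →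
      ∀ (S : Fin P.d → Finset ℕ) (A : HiggsLattice.VecField P 0) {δA : ℝ}, 0 ≤ δA →
        (∀ z ∈ cellBox k K₀ S, ∀ μ ν : Fin P.d, |A ⟨z.shift ν, μ⟩ - A ⟨z, μ⟩| ≤ δA) →
        (P.L : ℝ) ^ k * δA * |C.e| ≤ t →
        ∀ (j : ℕ) (μ : Fin P.d) (x₁ x₂ x : HiggsLattice.Site P 0), x₂ ≠ x₁ →
          x₁ ∈ cellBox k K₀ S → x₁.shift μ ∈ cellBox k K₀ S → x₂ ∈ cellBox k K₀ S → x₂.shift μ ∈ cellBox k K₀ S →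
          x ∈ cellBox k K₀ S → ∀ Γ : List (HiggsLattice.Site P 0), IsAdm x₁ x₂ Γ → (∀ y ∈ Γ, y ∈ cellBox k K₀ S) →
          (((HiggsLattice.Site.tdist x₁ x₂ : ℝ) / (P.L : ℝ) ^ j)⁻¹) ^ α * holderTermR C (cellBox k K₀ S) A msq a k j μ x₁ x₂ x Γ
            ≤ Cst * (P.mesh j * (P.mesh j ^ P.d)⁻¹) *
              Real.exp (-(δ₁ * (min (HiggsLattice.Site.tdist x₁ x : ℝ) (HiggsLattice.Site.tdist x₂ x : ℝ) / (P.L : ℝ) ^ j))) := by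
  have hL1 : 1 < L := by omega
  obtain ⟨t₃, c₁, ρ₃, ht₃, hc₁, hρ₃, hCov⟩ := B1Prop23RegularRegionSmall.prop23_regular_region_small d L hL1 ha hmsq N
  obtain ⟨K₁, hV⟩ := norm_propagatorK_box_reg_decay_sum d L hd hL ha hmsq N C 1 1 1 zero_le_one one_pos
  obtain ⟨K₄, hHol⟩ := norm_holder_propagatorK_box_reg_decay_sum d L hd hL ha hmsq N C 1 1 1 zero_le_one one_pos
  refine ⟨max (max K₁ K₄) 1, fun {α} hα0 hα1 K₀ hK₀ => ?_⟩
  have hK₁ : K₁ ≤ K₀ := ((le_max_left _ _).trans (le_max_left _ _)).trans hK₀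
  have hK₄ : K₄ ≤ K₀ := ((le_max_right _ _).trans (le_max_left _ _)).trans hK₀
  have hK₀1 : 1 ≤ K₀ := (le_max_right _ _).trans hK₀
  obtain ⟨c₀, e₁, hc₀, he₁, hV⟩ := hV K₀ hK₁
  obtain ⟨cH, eH, hcH, heH, hH⟩ := hHol hα0 hα1 K₀ hK₄
  -- the common rate, the smallness threshold and the constant
  obtain ⟨δ, hδ⟩ : ∃ δ : ℝ, δ = min (1 / (4 * (K₀ : ℝ))) ρ₃ := ⟨_, rfl⟩
  have hδpos : 0 < δ := by rw [hδ]; exact lt_min (by positivity) hρ₃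
  have hδ₁ : δ ≤ 1 / (4 * K₀) := by rw [hδ]; exact min_le_left _ _
  have hδ₃ : δ ≤ ρ₃ := by rw [hδ]; exact min_le_right _ _
  have hLpos : (0 : ℝ) < L := by exact_mod_cast (by omega : 0 < L)
  refine ⟨min (min e₁ eH) t₃, δ / (2 * L), cst211 d L N a c₀ cH c₁ δ, lt_min (lt_min he₁ heH) ht₃,
    div_pos hδpos (by positivity), cst211_pos hc₀.le hcH.le hc₁.le, ?_⟩
  intro P hPd hPL hK₀M k hk1 hkK h3 hmesh S A δA hδA hreg ht j μ x₁ x₂ x hne hx₁ hx₁μ hx₂ hx₂μ hx Γ hΓ hΓΩ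
  subst hPd hPL
  set Ω : Finset (HiggsLattice.Site P 0) := cellBox k K₀ S with hΩdef
  have hL1' : 1 < P.L := hL1
  have hLr : 1 < (P.L : ℝ) := by exact_mod_cast hL1'
  have hLge1 : (1 : ℝ) ≤ P.L := hLr.le
  have hCst : 0 ≤ cst211 P.d P.L N a c₀ cH c₁ δ := (cst211_pos hc₀.le hcH.le hc₁.le).le
  have hte₁ : (P.L : ℝ) ^ k * δA * |C.e| ≤ e₁ := ht.trans ((min_le_left _ _).trans (min_le_left _ _))
  have hteH : (P.L : ℝ) ^ k * δA * |C.e| ≤ eH := ht.trans ((min_le_left _ _).trans (min_le_right _ _))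
  have hte₃ : (P.L : ℝ) ^ k * δA * |C.e| ≤ t₃ := ht.trans (min_le_right _ _)
  have hΩ : IsBigBlockUnion k K₀ Ω := isBigBlockUnion_cellBox S
  have hΩl : ∀ {l : ℕ}, l ≤ k → ∀ x x' : HiggsLattice.Site P 0, blockIter l x = blockIter l x' → (x ∈ Ω ↔ x' ∈ Ω) :=
    fun hl => blockUnion_of_isBigBlockUnion hl hΩ
  have hΩeq : ∀ {l : ℕ}, l ≤ k → cellBox l K₀ (refineS P k l S) = Ω := fun hl => (cellBox_eq_cellBox_of_le hl S).symm
  -- (I.2.25) value at level `l`, engine form, at EVERY point of `Ω`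
  have hGl : ∀ {l : ℕ}, 1 ≤ l → l ≤ k → ∀ (g : ScalarField P 0 N) (M D : ℝ), (∀ x, ‖g x‖ ≤ M) → 0 ≤ D →
      ∀ x, x ∈ Ω → (∀ z, g z ≠ 0 → D ≤ (HiggsLattice.Site.tdist x z : ℝ)) →
        ‖propagatorK C Ω A msq a l g x‖ ≤ c₀ * P.mesh l ^ 2 * Real.exp (-(δ * (D / (P.L : ℝ) ^ l))) * M := by
    intro l hl1 hlk g M D hg hD0 x hx hsupp
    have hmesh_l : P.mesh l ≤ 1 := (mesh_mono P hlk).trans hmesh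
    have h3l : ∀ μ, 3 * half P l K₀ ≤ P.sitesPerDir 0 μ := fun μ => (Nat.mul_le_mul_left _ (half_mono hlk)).trans (h3 μ)
    have hak : 0 ≤ B1.aSeq a P.L l := (B1.aSeq_pos ha hLr hl1).le
    have h0 := hV P rfl rfl hK₀M hl1 (hlk.trans hkK) h3l hmesh_l (refineS P k l S) A he₁ le_rfl
    rw [hΩeq hlk] at h0
    have h := h0 (reg223R_of_small C Ω A hlk hmesh_l he₁ hδA hreg hte₁ le_rfl) x g M D hg hD0 hsupp
    rw [← propagatorK_apply_eq_chi C A hmsq hak (hΩl hlk) g hx] at h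
    refine h.trans ?_
    have hM : 0 ≤ M := (norm_nonneg _).trans (hg x)
    have hLl : (0 : ℝ) < (P.L : ℝ) ^ l := pow_pos (by exact_mod_cast P.hL) l
    have hexp := exp_p35_le (P := P) (by omega : 0 < K₀) hδ₁ hD0 hLl
    exact mul_le_mul_of_nonneg_right (mul_le_mul_of_nonneg_left hexp (by positivity)) hM
  -- (I.2.24) Hölder at level `l`, engine form, at EVERY pair of bonds of `Ω` along contours inside `Ω`
  have hHl : ∀ {l : ℕ}, 1 ≤ l → l ≤ k → ∀ (g : ScalarField P 0 N) (M D : ℝ), (∀ x, ‖g x‖ ≤ M) → 0 ≤ D →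
      ∀ (μ : Fin P.d) (x x' : HiggsLattice.Site P 0), x' ≠ x → x ∈ Ω → x.shift μ ∈ Ω → x' ∈ Ω → x'.shift μ ∈ Ω →
        ∀ Γ : List (HiggsLattice.Site P 0), IsTChain x Γ → pathEnd x Γ = x' → (∀ y ∈ Γ, y ∈ Ω) →
        (Γ.length : ℝ) ≤ (P.d : ℝ) * HiggsLattice.Site.tdist x x' →
        (∀ z, g z ≠ 0 → D ≤ (HiggsLattice.Site.tdist x z : ℝ)) → (∀ z, g z ≠ 0 → D ≤ (HiggsLattice.Site.tdist x' z : ℝ)) →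
          (((HiggsLattice.Site.tdist x x' : ℝ) / (P.L : ℝ) ^ l)⁻¹) ^ α *
              ‖hol C A x Γ (covDeriv C A (propagatorK C Ω A msq a l g) ⟨x', μ⟩)
                - covDeriv C A (propagatorK C Ω A msq a l g) ⟨x, μ⟩‖
            ≤ cH * P.mesh l * Real.exp (-(δ * (D / (P.L : ℝ) ^ l))) * M := by
    intro l hl1 hlk g M D hg hD0 μ x x' hne' hxΩ hxμ hx'Ω hx'μ Γ' hch hend hΓ'Ω hlen hDx hDx'
    have hmesh_l : P.mesh l ≤ 1 := (mesh_mono P hlk).trans hmesh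
    have h3l : ∀ μ, 3 * half P l K₀ ≤ P.sitesPerDir 0 μ := fun μ => (Nat.mul_le_mul_left _ (half_mono hlk)).trans (h3 μ)
    have hak : 0 ≤ B1.aSeq a P.L l := (B1.aSeq_pos ha hLr hl1).le
    have h0 := hH P rfl rfl hK₀M hl1 (hlk.trans hkK) h3l hmesh_l (refineS P k l S) A heH le_rfl
    rw [hΩeq hlk] at h0
    have h := h0 (reg223R_of_small C Ω A hlk hmesh_l heH hδA hreg hteH le_rfl) μ x x' hne' hxΩ hxμ hx'Ω hx'μ Γ' hch hend hΓ'Ω hlen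
      g M D hg hD0 hDx hDx'
    -- `D^ε_A(G(1_Ωg))` and `D^ε_A(Gg)` agree at bonds inside `Ω`
    have hcut : ∀ y ∈ Ω, propagatorK C Ω A msq a l (chi Ω • g) y = propagatorK C Ω A msq a l g y :=
      fun y hy => (propagatorK_apply_eq_chi C A hmsq hak (hΩl hlk) g hy).symm
    rw [covDeriv_congr_bond C A (b := ⟨x, μ⟩) (hcut _ hxΩ) (hcut _ hxμ),
      covDeriv_congr_bond C A (b := ⟨x', μ⟩) (hcut _ hx'Ω) (hcut _ hx'μ)] at h
    refine h.trans ?_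
    have hM : 0 ≤ M := (norm_nonneg _).trans (hg x)
    have hml : 0 < P.mesh l := P.mesh_pos l
    have hLl : (0 : ℝ) < (P.L : ℝ) ^ l := pow_pos (by exact_mod_cast P.hL) l
    have hexp := exp_p35_le (P := P) (by omega : 0 < K₀) hδ₁ hD0 hLl
    exact mul_le_mul_of_nonneg_right (mul_le_mul_of_nonneg_left hexp (by positivity)) hM
  -- (I.2.34) at level `l < k` on `Ω^{(l)} × Ω^{(l)}` (p35 g16's `prop23_regular_region_small`)
  have hCl : ∀ {l : ℕ}, 1 ≤ l → l < k → ∀ s t : HiggsLattice.Site P l × Ix N, s.1 ∈ levelSet l Ω → t.1 ∈ levelSet l Ω →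
      |mat (fluctCovA C Ω A msq a l) s t| ≤ c₁ * P.mesh l ^ 2 * Real.exp (-(δ * (HiggsLattice.Site.tdist s.1 t.1 : ℝ))) := by
    intro l hl1 hlk s t hs ht'
    obtain ⟨j', rfl⟩ : ∃ j', l = j' + 1 := ⟨l - 1, by omega⟩
    have hmesh_l : P.mesh (j' + 1) ≤ 1 := (mesh_mono P hlk.le).trans hmesh
    have hjK : j' + 1 < P.K := lt_of_lt_of_le hlk hkK
    have htl : (P.L : ℝ) ^ (j' + 1) * δA * |C.e| ≤ t₃ := by
      have hpow : (P.L : ℝ) ^ (j' + 1) ≤ (P.L : ℝ) ^ k := pow_le_pow_right₀ hLge1 hlk.le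
      exact (mul_le_mul_of_nonneg_right (mul_le_mul_of_nonneg_right hpow hδA) (abs_nonneg _)).trans hte₃
    have hjk : j' < k := by omega
    have hpf : B2Eq328ConcretePieces.pieceF (towerR Ω k) ⟨j', hjk⟩ = Ω := pieceF_towerR ⟨j', hjk⟩ (hΩl hlk.le)
    have hregF : ∀ z ∈ B2Eq328ConcretePieces.pieceF (towerR Ω k) ⟨j', hjk⟩, ∀ μ' ν : Fin P.d,
        |A ⟨z.shift ν, μ'⟩ - A ⟨z, μ'⟩| ≤ δA := by
      rw [hpf]; exact hreg
    have hj2 : j' + 2 ≤ k := by omega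
    have hΛ := levelSet_blockUnion hjK.le (hΩl hlk.le) (hΩl hj2)
    have h := (hCov C P rfl rfl (towerR Ω k) hkK ⟨j', hjk⟩ hjK hmesh_l hΛ A hδA hregF htl (Λ := levelSet (j' + 1) Ω)
      (subset_refl _) hs ht').1
    rw [hpf, mat_condCov232_levelSet C A hjK.le hmsq ha hLr (hΩl hlk.le) (hΩl hj2) hs] at h
    refine h.trans ?_
    have hexp : Real.exp (-(ρ₃ * (HiggsLattice.Site.tdist s.1 t.1 : ℝ))) ≤
        Real.exp (-(δ * (HiggsLattice.Site.tdist s.1 t.1 : ℝ))) :=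
      exp_le_exp_of_le (mul_le_mul_of_nonneg_right hδ₃ (Nat.cast_nonneg _))
    calc P.mesh (j' + 1) ^ 2 * c₁ * Real.exp (-(ρ₃ * (HiggsLattice.Site.tdist s.1 t.1 : ℝ)))
        ≤ P.mesh (j' + 1) ^ 2 * c₁ * Real.exp (-(δ * (HiggsLattice.Site.tdist s.1 t.1 : ℝ))) :=
          mul_le_mul_of_nonneg_left hexp (by positivity)
      _ = _ := by ring
  -- rate bookkeeping
  have hrate : δ / (2 * P.L) ≤ δ / 2 := by
    rw [div_le_div_iff₀ (by positivity) (by norm_num : (0 : ℝ) < 2)]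
    nlinarith
  have hexp0 : ∀ m : ℝ, 0 ≤ m →
      Real.exp (-(δ * (m / (P.L : ℝ) ^ 1))) ≤ Real.exp (-(δ / (2 * P.L) * (m / (P.L : ℝ) ^ 0))) := by
    intro m hm
    apply exp_le_exp_of_le
    rw [pow_one, pow_zero, div_one]
    have h0 : 0 ≤ δ * (m / P.L) := by positivity
    calc δ / (2 * P.L) * m = (1 / 2) * (δ * (m / P.L)) := by ring
      _ ≤ δ * (m / P.L) := by linarith
  have hexpj : ∀ (j : ℕ) (m : ℝ), 0 ≤ m →
      Real.exp (-(δ / 2 * (m / (P.L : ℝ) ^ j))) ≤ Real.exp (-(δ / (2 * P.L) * (m / (P.L : ℝ) ^ j))) :=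
    fun j m hm => exp_rate_mono hrate (by positivity)
  have hmj : 0 < P.mesh j := P.mesh_pos j
  have hmin : 0 ≤ min (HiggsLattice.Site.tdist x₁ x : ℝ) (HiggsLattice.Site.tdist x₂ x : ℝ) :=
    le_min (Nat.cast_nonneg _) (Nat.cast_nonneg _)
  rcases Nat.eq_zero_or_pos j with rfl | hj1
  · -- the piece `G^η_{(0)} = G^ε_1(Ω,A)`: (I.2.24) at level `1`
    refine (holder_pieceB_zero_le C Ω A msq (k := k) hα0 (hHl le_rfl hk1) μ hne hx₁ hx₁μ hx₂ hx₂μ x hΓ hΓΩ).trans ?_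
    exact mul_le_mul (mul_le_mul_of_nonneg_right (le_cst211_zero hc₀.le hcH.le hc₁.le) (by positivity)) (hexp0 _ hmin)
      (Real.exp_pos _).le (by positivity)
  · by_cases hjk : j < k
    · refine (holder_pieceB_pos_le C Ω A msq ha hL1' hj1 hjk (hjk.le.trans hkK) hmsq (hΩl hjk.le) hc₀.le hcH.le
        hc₁.le hδpos (hGl hj1 hjk.le) (hHl hj1 hjk.le) (hCl hj1 hjk) μ hne hx₁ hx₁μ hx₂ hx₂μ hx hΓ hΓΩ).trans ?_
      exact mul_le_mul (mul_le_mul_of_nonneg_right (le_cst211_pos hc₀.le hcH.le hc₁.le) (by positivity)) (hexpj j _ hmin)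
        (Real.exp_pos _).le (by positivity)
    · rw [holderTermR_eq_zero_of_le C Ω A msq hj1 (not_lt.mp hjk), mul_zero]
      positivity

/-- **THE SAME IN PRINT'S UNITS** — `|(δ_αG^η_{(j)}(Ω,B̃))(x₁,x₂;x)| ≤ O(1)(L^jη)^{−d+1−α}e^{−δ₁(L^jη)^{−1}min{|x₁−x|,|x₂−x|}}` read, for every
admissible contour inside the box, as `holderTermR/(ε|x₁−x₂|)^α ≤ C(L^jη)^{1−d−α}e^{−δ₁(L^jη)^{−1}·ε·min(…)}` (the form of this seat's
`ineq211At_regularRegion_small_explicit`, now at every pair of bonds and every source of a cell-product box).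
[cite: Balaban1983Higgs3, (2.11) p.426] [cite: Balaban1982Higgs1, Prop. 2.1 p.610, p.611 l.1–2] -/
theorem ineq211At_regularBox_explicit_small (d L : ℕ) (hd : 1 ≤ d) (hL : 2 ≤ L) {a : ℝ} (ha : 0 < a) {msq : ℝ}
    (hmsq : 0 < msq) (N : ℕ) (C : ChargeData N) :
    ∃ K₀min : ℕ, ∀ {α : ℝ}, 0 ≤ α → α < 1 → ∀ K₀ : ℕ, K₀min ≤ K₀ → ∃ t δ₁ Cst : ℝ, 0 < t ∧ 0 < δ₁ ∧ 0 < Cst ∧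
      ∀ (P : HiggsLattice.Params), P.d = d → P.L = L → K₀ ∣ P.M →
      ∀ {k : ℕ}, 1 ≤ k → k ≤ P.K → (∀ μ, 3 * half P k K₀ ≤ P.sitesPerDir 0 μ) → P.mesh k ≤ 1 →
      ∀ (S : Fin P.d → Finset ℕ) (A : HiggsLattice.VecField P 0) {δA : ℝ}, 0 ≤ δA →
        (∀ z ∈ cellBox k K₀ S, ∀ μ ν : Fin P.d, |A ⟨z.shift ν, μ⟩ - A ⟨z, μ⟩| ≤ δA) →
        (P.L : ℝ) ^ k * δA * |C.e| ≤ t →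
        ∀ (j : ℕ) (μ : Fin P.d) (x₁ x₂ x : HiggsLattice.Site P 0), x₂ ≠ x₁ →
          x₁ ∈ cellBox k K₀ S → x₁.shift μ ∈ cellBox k K₀ S → x₂ ∈ cellBox k K₀ S → x₂.shift μ ∈ cellBox k K₀ S →
          x ∈ cellBox k K₀ S → ∀ Γ : List (HiggsLattice.Site P 0), IsAdm x₁ x₂ Γ → (∀ y ∈ Γ, y ∈ cellBox k K₀ S) →
          holderTermR C (cellBox k K₀ S) A msq a k j μ x₁ x₂ x Γ / (P.mesh 0 * (HiggsLattice.Site.tdist x₁ x₂ : ℝ)) ^ α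
            ≤ Cst * P.mesh j ^ ((1 : ℝ) - (P.d : ℝ) - α) *
              Real.exp (-(δ₁ * (P.mesh j)⁻¹ *
                (P.mesh 0 * min (HiggsLattice.Site.tdist x₁ x : ℝ) (HiggsLattice.Site.tdist x₂ x : ℝ)))) := by
  obtain ⟨K₀min, h⟩ := holder_pieceR_box_bounds_small d L hd hL ha hmsq N C
  refine ⟨K₀min, fun {α} hα0 hα1 K₀ hK₀ => ?_⟩
  obtain ⟨t, δ₁, Cst, ht, hδ₁, hCst, h⟩ := h hα0 hα1 K₀ hK₀
  refine ⟨t, δ₁, Cst, ht, hδ₁, hCst, ?_⟩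
  intro P hPd hPL hK₀M k hk1 hkK h3 hmesh S A δA hδA hreg ht' j μ x₁ x₂ x hne hx₁ hx₁μ hx₂ hx₂μ hx Γ hΓ hΓΩ
  have hh := h P hPd hPL hK₀M hk1 hkK h3 hmesh S A hδA hreg ht' j μ x₁ x₂ x hne hx₁ hx₁μ hx₂ hx₂μ hx Γ hΓ hΓΩ
  set tt : ℝ := (HiggsLattice.Site.tdist x₁ x₂ : ℝ) with htt
  set E : ℝ := Real.exp (-(δ₁ * (min (HiggsLattice.Site.tdist x₁ x : ℝ) (HiggsLattice.Site.tdist x₂ x : ℝ) / (P.L : ℝ) ^ j)))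
    with hE
  have hm0 : 0 < P.mesh 0 := P.mesh_pos 0
  have hmj : 0 < P.mesh j := P.mesh_pos j
  have hLj : (0 : ℝ) < (P.L : ℝ) ^ j := pow_pos (by exact_mod_cast P.hL) j
  have ht1 : 1 ≤ tt := by rw [htt]; exact_mod_cast one_le_tdist_of_ne' hne
  have ht0 : 0 < tt := by linarith
  have hu : 0 < tt / (P.L : ℝ) ^ j := div_pos ht0 hLj
  have hdist : 0 < (P.mesh 0 * tt) ^ α := Real.rpow_pos_of_pos (mul_pos hm0 ht0) _
  have hexp : Real.exp (-(δ₁ * (P.mesh j)⁻¹ *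
      (P.mesh 0 * min (HiggsLattice.Site.tdist x₁ x : ℝ) (HiggsLattice.Site.tdist x₂ x : ℝ)))) = E := by
    rw [hE, mul_assoc δ₁, scale_inv_mul]
  rw [hexp, div_le_iff₀ hdist]
  have hrhs : Cst * P.mesh j ^ ((1 : ℝ) - (P.d : ℝ) - α) * E * (P.mesh 0 * tt) ^ α
      = Cst * (P.mesh j * (P.mesh j ^ P.d)⁻¹) * E * (tt / (P.L : ℝ) ^ j) ^ α := by
    rw [rpow_one_sub_sub, ← weight_eq j ht0.le]; ring
  rw [hrhs]
  have hW : (((tt / (P.L : ℝ) ^ j))⁻¹) ^ α = ((tt / (P.L : ℝ) ^ j) ^ α)⁻¹ := Real.inv_rpow hu.le α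
  have hWpos : 0 < (tt / (P.L : ℝ) ^ j) ^ α := Real.rpow_pos_of_pos hu _
  rw [hW, inv_mul_le_iff₀ hWpos] at hh
  calc holderTermR C (cellBox k K₀ S) A msq a k j μ x₁ x₂ x Γ
      ≤ (tt / (P.L : ℝ) ^ j) ^ α * (Cst * (P.mesh j * (P.mesh j ^ P.d)⁻¹) * E) := hh
    _ = _ := by ring

end MainB

end Literature.MathematicalPhysics.QuantumFieldTheory.Balaban1983to89.B3Ineq211RegularBox

end
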